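import Literature.NumberTheory.LFunctions.RiemannXiHadamardProduct
import Literature.NumberTheory.LFunctions.ZetaZeroReciprocalSum
import Literature.NumberTheory.LFunctions.RiemannHypothesisUpTo101
import Literature.NumberTheory.LFunctions.ZetaFirstZeroCertificate
import Literature.NumberTheory.LFunctions.ZetaRealAxis
import HarnessLib

/-!
# RiemannHypothesis / LeeYang — `LeeyangCumulantAlternationXi`, part 2: the Hadamard multiset of
`ξ` against the tree's zero certificates

Route `RiemannHypothesis/LeeYang`, item `stmt-RiemannHypothesis-0456` (`LeeyangCumulantAlternationXi`).
ARITHMETIC half of the proof: what the tree knows about the numbers `bₖ` of a Hadamard sequence `b`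
of `H₀` (`Literature.NumberTheory.LFunctions.IsHadamardSeq 0 b`).  Each non-zero `bₖ` is `1/(2ρₖ−1)²`
for a non-trivial zero `ρₖ = xiZero b k` of `ζ` (`eq_one_div_sq`, tree: `riemannZeta_xiZero`), and

* `|Im ρ| > 14` for every non-trivial zero (`fourteen_lt_abs_im_of_zero`; tree: `N(14) = 0`,
  `riemannZeta_ne_zero_of_im_pos_of_im_le_fourteen`, no real zeros `ZetaRealAxis`);
* `Re ρ = ½` whenever `|Im ρ| ≤ 101` (`re_eq_half_of_abs_im_le`; tree: the kernel-checked
  certificate `N(101) = N₀(101) = 29`, `riemannHypothesisInStripUpTo_hundredOne`);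
* the first zero: some `bₖ = −1/(4γ²)` with `γ ∈ [225/16, 227/16]` (`exists_index_first_zero`;
  tree: `exists_zero_Icc_first_bracket` + multiplicities of the Hadamard product, `mult_pos`);
* `∑ₖ Re(−4bₖ/(1−bₖ)) = ξ'/ξ(1) = β/2`, `β = nicolasBeta = 2 + γ − log π − 2 log 2 < 0.0474`
  (`hasSum_re_terms_one`; tree: `logDeriv_riemannXi_eq_tsum`, `logDeriv_riemannXi_one`), where
  `−4bₖ/(1−bₖ) = 1/(ρₖ(1−ρₖ))` has non-negative real part dominating `‖bₖ‖`
  (`norm_le_re_term`, elementary: `|γ| > 14`).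

No new definitions; everything is a theorem about an arbitrary Hadamard sequence `b`.
-/

noncomputable section

namespace Summit.RiemannHypothesis.LeeYang

open Complex Literature.NumberTheory.LFunctions
open scoped ComplexConjugate

variable {b : ℕ → ℂ}

/-! ### Location of the non-trivial zeros (tree certificates) -/

/-- Every zero of `ζ` in the open critical strip has `|Im ρ| > 14` (`N(14) = 0`, conjugation
symmetry, and no real zeros in the strip). -/
theorem fourteen_lt_abs_im_of_zero {ρ : ℂ} (hz : riemannZeta ρ = 0) (h0 : 0 < ρ.re)
    (h1 : ρ.re < 1) : 14 < |ρ.im| := by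
  have him : ρ.im ≠ 0 := im_ne_zero_of_riemannZeta_eq_zero hz h0 h1
  by_contra hle
  rw [not_lt] at hle
  rcases him.lt_or_gt with hneg | hpos
  · have hz' : riemannZeta (conj ρ) = 0 := by rw [riemannZeta_conj, hz, map_zero]
    have hpos' : 0 < (conj ρ).im := by rw [conj_im]; linarith
    refine riemannZeta_ne_zero_of_im_pos_of_im_le_fourteen hpos' ?_ hz'
    rw [conj_im]
    rw [abs_of_neg hneg] at hle
    linarith
  · exact riemannZeta_ne_zero_of_im_pos_of_im_le_fourteen hpos ((le_abs_self _).trans hle) hz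

/-- Every zero of `ζ` in the open critical strip with `|Im ρ| ≤ 101` lies on the critical line
(the tree's kernel-checked Backlund certificate `N(101) = N₀(101) = 29`,
`riemannHypothesisInStripUpTo_hundredOne`). -/
theorem re_eq_half_of_abs_im_le {ρ : ℂ} (hz : riemannZeta ρ = 0) (h0 : 0 < ρ.re) (h1 : ρ.re < 1)
    (hT : |ρ.im| ≤ 101) : ρ.re = 1 / 2 :=
  riemannHypothesisInStripUpTo_hundredOne ρ hz h0 h1 hT

/-! ### Elementary estimates for `1/(2ρ−1)²` and `1/(ρ(1−ρ))` -/

/-- `‖1/(2ρ−1)²‖ ≤ 1/(4 (Im ρ)²)` (`Im ρ ≠ 0`). -/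
theorem norm_one_div_sq_le {ρ : ℂ} (hγ : ρ.im ≠ 0) : ‖1 / (2 * ρ - 1) ^ 2‖ ≤ 1 / (4 * ρ.im ^ 2) := by
  rw [norm_div, norm_one, norm_pow]
  have h1 : 2 * |ρ.im| ≤ ‖2 * ρ - 1‖ := by
    have h := abs_im_le_norm (2 * ρ - 1)
    have e : (2 * ρ - 1).im = 2 * ρ.im := by simp
    rw [e, abs_mul, abs_two] at h
    exact h
  have h2 : 4 * ρ.im ^ 2 ≤ ‖2 * ρ - 1‖ ^ 2 := by nlinarith [abs_nonneg ρ.im, sq_abs ρ.im]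
  have h3 : 0 < 4 * ρ.im ^ 2 := by positivity
  exact one_div_le_one_div_of_le h3 h2

/-- On the critical line `1/(2ρ−1)² = −1/(4γ²)` (`γ = Im ρ ≠ 0`). -/
theorem one_div_sq_of_re_eq_half {ρ : ℂ} (hre : ρ.re = 1 / 2) (hγ : ρ.im ≠ 0) :
    1 / (2 * ρ - 1) ^ 2 = ((-(1 / (4 * ρ.im ^ 2)) : ℝ) : ℂ) := by
  have e : 2 * ρ - 1 = ((2 * ρ.im : ℝ) : ℂ) * I := by
    apply Complex.ext
    · simp [hre]
    · simp
  rw [e, mul_pow, I_sq]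
  have hγ' : ((2 * ρ.im : ℝ) : ℂ) ≠ 0 := by exact_mod_cast mul_ne_zero two_ne_zero hγ
  push_cast
  field_simp
  ring

/-- The real part of `(2ρ−1)²` is negative when `|Re(2ρ−1)| < 2|Im ρ|`; in the strip with
`|Im ρ| > 14` this gives `Re(−1/(2ρ−1)²) ≥ 0`. -/
theorem re_neg_one_div_sq_nonneg {ρ : ℂ} (h0 : 0 < ρ.re) (h1 : ρ.re < 1) (hγ : 14 < |ρ.im|) :
    0 ≤ (-(1 / (2 * ρ - 1) ^ 2)).re := by
  rw [neg_re, one_div, inv_re, neg_nonneg]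
  refine div_nonpos_of_nonpos_of_nonneg ?_ (Complex.normSq_nonneg _)
  have e : ((2 * ρ - 1) ^ 2).re = (2 * ρ.re - 1) ^ 2 - 4 * ρ.im ^ 2 := by
    simp [sq, mul_re, mul_im]; ring
  rw [e]
  have : 196 < ρ.im ^ 2 := by
    have h := sq_abs ρ.im
    nlinarith [abs_nonneg ρ.im]
  nlinarith

/-- `Re 1/(ρ(1−ρ)) = (β(1−β)+γ²)/|ρ(1−ρ)|²`. -/
theorem re_one_div_mul_one_sub (ρ : ℂ) :
    (1 / (ρ * (1 - ρ))).re = (ρ.re * (1 - ρ.re) + ρ.im ^ 2) / Complex.normSq (ρ * (1 - ρ)) := by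
  rw [one_div, inv_re]
  congr 1
  simp [mul_re]
  ring

/-- `|ρ(1−ρ)|² = (β(1−β)+γ²)² + γ²(1−2β)²`. -/
theorem normSq_mul_one_sub (ρ : ℂ) : Complex.normSq (ρ * (1 - ρ)) =
    (ρ.re * (1 - ρ.re) + ρ.im ^ 2) ^ 2 + (ρ.im * (1 - 2 * ρ.re)) ^ 2 := by
  rw [Complex.normSq_apply]
  simp [mul_re, mul_im]
  ring

/-- `Re 1/(ρ(1−ρ)) ≥ 0` in the closed critical strip. -/
theorem re_one_div_mul_one_sub_nonneg {ρ : ℂ} (h0 : 0 ≤ ρ.re) (h1 : ρ.re ≤ 1) :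
    0 ≤ (1 / (ρ * (1 - ρ))).re := by
  rw [re_one_div_mul_one_sub]
  exact div_nonneg (by nlinarith [sq_nonneg ρ.im]) (Complex.normSq_nonneg _)

/-- **`‖1/(2ρ−1)²‖ ≤ Re 1/(ρ(1−ρ))`** for `0 < Re ρ < 1`, `|Im ρ| > 14` (indeed
`A·D − A² − C² = (2β−1)²β(1−β) + A(3γ² − β(1−β)) ≥ 0` with `A = β(1−β)+γ²`, `C = γ(1−2β)`,
`D = (2β−1)²+4γ²`). -/
theorem norm_one_div_sq_le_re {ρ : ℂ} (h0 : 0 < ρ.re) (h1 : ρ.re < 1) (hγ : 14 < |ρ.im|) :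
    ‖1 / (2 * ρ - 1) ^ 2‖ ≤ (1 / (ρ * (1 - ρ))).re := by
  have hγ2 : 196 < ρ.im ^ 2 := by
    have h := sq_abs ρ.im
    nlinarith [abs_nonneg ρ.im]
  have hD : ‖1 / (2 * ρ - 1) ^ 2‖ = 1 / ((2 * ρ.re - 1) ^ 2 + 4 * ρ.im ^ 2) := by
    rw [norm_div, norm_one, norm_pow, Complex.sq_norm, Complex.normSq_apply]
    congr 1
    simp
    ring
  rw [hD, re_one_div_mul_one_sub, normSq_mul_one_sub]
  set β := ρ.re
  set γ := ρ.im
  have hA : 0 < β * (1 - β) + γ ^ 2 := by nlinarith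
  have hDpos : 0 < (2 * β - 1) ^ 2 + 4 * γ ^ 2 := by nlinarith [sq_nonneg (2 * β - 1)]
  have hN : 0 < (β * (1 - β) + γ ^ 2) ^ 2 + (γ * (1 - 2 * β)) ^ 2 := by positivity
  rw [div_le_div_iff₀ hDpos hN, one_mul]
  have key : (β * (1 - β) + γ ^ 2) * ((2 * β - 1) ^ 2 + 4 * γ ^ 2) -
      ((β * (1 - β) + γ ^ 2) ^ 2 + (γ * (1 - 2 * β)) ^ 2) =
      (2 * β - 1) ^ 2 * (β * (1 - β)) + (β * (1 - β) + γ ^ 2) * (3 * γ ^ 2 - β * (1 - β)) := by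
    ring
  have t1 : 0 ≤ (2 * β - 1) ^ 2 * (β * (1 - β)) :=
    mul_nonneg (sq_nonneg _) (mul_nonneg h0.le (by linarith))
  have t2 : 0 ≤ (β * (1 - β) + γ ^ 2) * (3 * γ ^ 2 - β * (1 - β)) :=
    mul_nonneg hA.le (by nlinarith)
  linarith

/-- `−4b/(1−b) = 1/(ρ(1−ρ))` for `b = 1/(2ρ−1)²` (`ρ ≠ 0, 1`, `2ρ ≠ 1`). -/
theorem neg_four_mul_div_eq {ρ : ℂ} (h0 : ρ ≠ 0) (h1 : ρ ≠ 1) (h2 : 2 * ρ - 1 ≠ 0) :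
    -(4 * (1 / (2 * ρ - 1) ^ 2)) / (1 - 1 / (2 * ρ - 1) ^ 2) = 1 / (ρ * (1 - ρ)) := by
  have h3 : (2 * ρ - 1) ^ 2 - 1 ≠ 0 := by
    have e : (2 * ρ - 1) ^ 2 - 1 = 4 * ρ * (ρ - 1) := by ring
    rw [e]
    exact mul_ne_zero (mul_ne_zero (by norm_num) h0) (sub_ne_zero.2 h1)
  have h4 : 1 - ρ ≠ 0 := sub_ne_zero.2 (Ne.symm h1)
  have h5 : 1 - 1 / (2 * ρ - 1) ^ 2 ≠ 0 := by
    intro h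
    apply h3
    have h' : 1 / (2 * ρ - 1) ^ 2 = 1 := by linear_combination -h
    rw [one_div, inv_eq_one] at h'
    rw [h', sub_self]
  rw [div_eq_div_iff h5 (mul_ne_zero h0 h4)]
  field_simp
  ring

/-! ### The Hadamard multiset -/

/-- Each non-zero `bₖ` is `1/(2ρₖ−1)²`, `ρₖ = xiZero b k` (from `(ρₖ − ½)² = 1/(4bₖ)`). -/
theorem eq_one_div_sq (k : ℕ) (hk : b k ≠ 0) :
    b k = 1 / (2 * IsHadamardSeq.xiZero b k - 1) ^ 2 := by
  have h := IsHadamardSeq.xiZero_sub_half_sq b k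
  have e : (2 * IsHadamardSeq.xiZero b k - 1) ^ 2 = 4 * (IsHadamardSeq.xiZero b k - 1 / 2) ^ 2 := by
    ring
  rw [e, h]
  field_simp

/-- For a non-zero `bₖ`: `ρₖ` is a zero of `ζ` with `0 < Re ρₖ < 1` and `|Im ρₖ| > 14`, and
`bₖ = 1/(2ρₖ−1)²`. -/
theorem xiZero_spec (hb : IsHadamardSeq 0 b) {k : ℕ} (hk : b k ≠ 0) :
    riemannZeta (IsHadamardSeq.xiZero b k) = 0 ∧ 0 < (IsHadamardSeq.xiZero b k).re ∧
      (IsHadamardSeq.xiZero b k).re < 1 ∧ 14 < |(IsHadamardSeq.xiZero b k).im| ∧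
      b k = 1 / (2 * IsHadamardSeq.xiZero b k - 1) ^ 2 := by
  obtain ⟨hz, h0, h1⟩ := hb.riemannZeta_xiZero hk
  exact ⟨hz, h0, h1, fourteen_lt_abs_im_of_zero hz h0 h1, eq_one_div_sq k hk⟩

/-- The `s = 1` terms of `ξ'/ξ`: for non-zero `bₖ`, `−4bₖ/(1−bₖ) = 1/(ρₖ(1−ρₖ))`. -/
theorem term_one_eq (hb : IsHadamardSeq 0 b) {k : ℕ} (hk : b k ≠ 0) :
    -(4 * b k) / (1 - b k) = 1 / (IsHadamardSeq.xiZero b k * (1 - IsHadamardSeq.xiZero b k)) := by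
  obtain ⟨-, h0, h1, -, hbk⟩ := xiZero_spec hb hk
  set ρ := IsHadamardSeq.xiZero b k
  have hρ0 : ρ ≠ 0 := fun h ↦ by rw [h] at h0; simp at h0
  have hρ1 : ρ ≠ 1 := fun h ↦ by rw [h] at h1; simp at h1
  have h2 : 2 * ρ - 1 ≠ 0 := fun h ↦ hk (by rw [hbk, h]; simp)
  rw [hbk]
  exact neg_four_mul_div_eq hρ0 hρ1 h2

/-- **Pointwise**: `0 ≤ Re(−4bₖ/(1−bₖ))` and `‖bₖ‖ ≤ Re(−4bₖ/(1−bₖ))` for every `k`. -/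
theorem norm_le_re_term (hb : IsHadamardSeq 0 b) (k : ℕ) :
    0 ≤ (-(4 * b k) / (1 - b k)).re ∧ ‖b k‖ ≤ (-(4 * b k) / (1 - b k)).re := by
  rcases eq_or_ne (b k) 0 with hk | hk
  · simp [hk]
  obtain ⟨-, h0, h1, hγ, hbk⟩ := xiZero_spec hb hk
  rw [term_one_eq hb hk]
  refine ⟨re_one_div_mul_one_sub_nonneg h0.le h1.le, ?_⟩
  rw [hbk]
  exact norm_one_div_sq_le_re h0 h1 hγ

/-- **`∑ₖ Re(−4bₖ/(1−bₖ)) = β/2`** (`β = nicolasBeta`): the partial-fraction series of `ξ'/ξ` at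
`s = 1` (`logDeriv_riemannXi_eq_tsum`) and `ξ'/ξ(1) = β/2` (`logDeriv_riemannXi_one`). -/
theorem hasSum_re_terms_one (hb : IsHadamardSeq 0 b) :
    HasSum (fun k ↦ (-(4 * b k) / (1 - b k)).re) (nicolasBeta / 2) := by
  have hs := hb.summable_logDeriv_riemannXi_terms 1
  have h := hb.logDeriv_riemannXi_eq_tsum (s := 1) (by rw [riemannXi_one]; norm_num)
  rw [logDeriv_riemannXi_one] at h
  have h2 : HasSum (fun n ↦ -(4 * b n * (2 * 1 - 1)) / (1 - b n * (2 * 1 - 1) ^ 2))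
      ((nicolasBeta : ℂ) / 2) := h ▸ hs.hasSum
  have h3 := Complex.hasSum_re h2
  have e : ((nicolasBeta : ℂ) / 2).re = nicolasBeta / 2 := by simp
  rw [e] at h3
  refine h3.congr_fun fun n ↦ ?_
  norm_num

/-- **The first zero in the Hadamard multiset**: some `bₖ` equals `−1/(4γ²)` with
`γ ∈ [225/16, 227/16]` (the certified bracket of `γ₁ = 14.1347…`; every zero of `ξ` kills a
factor of the Hadamard product, `IsHadamardSeq.mult_pos`). -/
theorem exists_index_first_zero (hb : IsHadamardSeq 0 b) :
    ∃ (k : ℕ) (γ : ℝ), 225 / 16 ≤ γ ∧ γ ≤ 227 / 16 ∧ b k = ((-(1 / (4 * γ ^ 2)) : ℝ) : ℂ) := by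
  obtain ⟨γ, ⟨hγ1, hγ2⟩, hz⟩ := exists_zero_Icc_first_bracket
  obtain ⟨ρ, hρ⟩ : ∃ ρ : ℂ, ρ = 1 / 2 + γ * I := ⟨_, rfl⟩
  have hre : ρ.re = 1 / 2 := by rw [hρ]; simp
  have him : ρ.im = γ := by rw [hρ]; simp
  have hγ0 : γ ≠ 0 := by
    intro h
    rw [h] at hγ1
    norm_num at hγ1
  rw [← hρ] at hz
  have hξ : riemannXi ρ = 0 :=
    (riemannXi_eq_zero_iff_holds ρ).2 ⟨hz, by rw [hre]; norm_num, by rw [hre]; norm_num⟩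
  have hH : deBruijnH 0 (xiToH ρ) = 0 := by
    have h := riemannXi_eq_deBruijnH ρ
    rw [hξ] at h
    have h' := h.symm
    simpa using h'
  have hm := hb.mult_pos hH
  unfold IsHadamardSeq.mult at hm
  obtain ⟨k, hk⟩ := Finset.card_pos.1 hm
  rw [hb.mem_zeroIndices, xiToH_sq] at hk
  refine ⟨k, γ, hγ1, hγ2, ?_⟩
  have hne : (2 * ρ - 1) ^ 2 ≠ 0 := by
    have e : 2 * ρ - 1 = ((2 * γ : ℝ) : ℂ) * I := by
      apply Complex.ext
      · simp [hre]
      · simp [him]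
    rw [e, mul_pow, I_sq]
    have : ((2 * γ : ℝ) : ℂ) ≠ 0 := by exact_mod_cast mul_ne_zero two_ne_zero hγ0
    simpa using this
  have hbk : b k = 1 / (2 * ρ - 1) ^ 2 := by
    rw [eq_div_iff hne]
    linear_combination -hk
  rw [hbk, one_div_sq_of_re_eq_half hre (him ▸ hγ0), him]

end Summit.RiemannHypothesis.LeeYang
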